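import Mathlib
import HarnessLib
import Summits.Langlands.Langlands.Theses.SkinnerWilesDefectOne
import Literature.NumberTheory.GaloisRepresentations.NearlyOrdinaryDeformationRing
import Summits.Langlands.Langlands.Theorems.SkinnerWilesDefectOneProModularOfEisensteinSeedReducibleLocus

/-!
# The prime of an irreducible point lies off the reducible locus (and so does its component)

Route `SkinnerWilesDefectOne`, support item stmt-Langlands-14718
(`ProModularOfEisensteinSeed : EisensteinProModularSeed → ReducibleOrdinaryProModular`).  In
Skinner–Wiles' step (III) the hypothesis "`ρ` irreducible" of the engine enters exactly once: the prime
`𝔭_ρ = ker φ` of `R_𝒟` classifying (a lattice of) `ρ` is NOT in the reducible locus, hence neither is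
the irreducible component `C_ρ ∋ 𝔭_ρ` (line `steinberg_hyperplane`, stub S5: "irreducibility ↦
`𝔭_ρ ∉ reducibleLocus`"; [SW, §4.3]: components through primes with `ρ_𝒟 mod 𝔭` irreducible).  This
file proves it for the tree's objects:

* `not_isIrreducible_of_isReducible` — a framed representation over a field that is conjugate to an
  upper-triangular one (`Deformation.IsReducible`) has the stable line `Q e₀`, so it is not irreducible
  (`Representation.IsIrreducible` of `toGaloisRep`);
* `not_mem_reducibleLocus_ker` — if `φ : R_𝒟 → ℚ̄_p` realises the IRREDUCIBLE continuous
  `ρ : Γ_F → GL₂(ℚ̄_p)` up to conjugation (`φ ∘ ρ_𝒟 = P⁻¹ ρ P`, the shape of `ModelData.Models.realizes`),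
  then `ker φ ∉ reducibleLocus 𝓡`: reducibility of `ρ_𝒟 mod ker φ` over `Frac(R_𝒟/ker φ)` would pass
  along the embedding `Frac(R_𝒟/ker φ) ↪ ℚ̄_p` extending `φ` (`IsFractionRing.lift`) to `φ ∘ ρ_𝒟 ~ ρ`;
* `not_mem_reducibleLocus_of_le` — the reducible locus being `V({c_γ}) ∪ V({b_γ})`
  (`reducibleLocus_eq_zeroLocus_union`, for a datum distinguished above `p`), it is closed under
  specialisation, so every prime BELOW a prime off the locus — in particular the minimal prime of the
  component `C_ρ` — is off the locus too.

References: C. M. Skinner, A. J. Wiles, Publ. Math. IHÉS 89 (1999), §2.2, §4.3. [SkinnerWiles1999]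
-/

set_option linter.dupNamespace false -- project-wide option (lakefile weak.linter.dupNamespace); `Summit.Langlands.Langlands` is the mandated namespace

namespace Summit.Langlands.Langlands.Theorems

open scoped NumberField MatrixGroups
open IsDedekindDomain Field Matrix IsLocalRing
open Literature.NumberTheory.GaloisRepresentations
open Literature.NumberTheory.GaloisRepresentations.Deformation

noncomputable section

/-! ### A stable line contradicts irreducibility -/

/-- **A representation conjugate to an upper-triangular one is not irreducible** (over a field, rank
two): the first column `w = Q e₀` of the conjugating matrix spans a stable line, a subrepresentation
which is neither `⊥` (`w ≠ 0`) nor `⊤` (dimension one). [folklore] -/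
theorem not_isIrreducible_of_isReducible {G : Type*} [Group G] [TopologicalSpace G] {K : Type*}
    [Field K] [TopologicalSpace K] [IsTopologicalRing K] (ρ : FramedRep G K 2)
    (h : IsReducible ρ.toMonoidHom) : ¬ ρ.toContinuousRep.IsIrreducible := by
  intro hirr
  have hso : IsSimpleOrder (Subrepresentation (FramedRep.toRepresentation ρ)) := hirr
  obtain ⟨Q, hQ⟩ := h
  -- the stable vector `w = Q e₀`
  set w : Fin 2 → K := fun i => Q.val i 0 with hw
  have hstab : ∀ g, (ρ g).val *ᵥ w = ((Q⁻¹ * ρ.toMonoidHom g * Q).val 0 0) • w := by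
    intro g
    -- `ρ g * Q = Q * (Q⁻¹ ρ g Q)` and the latter is upper triangular in column `0`
    have hGL : ρ.toMonoidHom g * Q = Q * (Q⁻¹ * ρ.toMonoidHom g * Q) := by group
    have hmat : (ρ g).val * Q.val = Q.val * (Q⁻¹ * ρ.toMonoidHom g * Q).val := by
      have := congrArg Units.val hGL
      rw [Units.val_mul, Units.val_mul] at this
      exact this
    ext i
    have e := congrFun (congrFun hmat i) 0
    simp only [Matrix.mul_apply, Fin.sum_univ_two, hQ g, mul_zero, add_zero] at e
    simp only [hw, Matrix.mulVec, dotProduct, Fin.sum_univ_two, Pi.smul_apply, smul_eq_mul]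
    linear_combination e
  let W : Subrepresentation (FramedRep.toRepresentation ρ) :=
    ⟨Submodule.span K {w}, fun g v hv => by
      obtain ⟨c, rfl⟩ := Submodule.mem_span_singleton.1 hv
      rw [map_smul, FramedRep.toRepresentation_apply_apply, hstab g, smul_smul]
      exact Submodule.mem_span_singleton.2 ⟨_, rfl⟩⟩
  have hw0 : w ≠ 0 := by
    intro h0
    apply col_zero_ne_zero Q
    exact ⟨congrFun h0 0, congrFun h0 1⟩
  rcases hso.eq_bot_or_eq_top W with hbot | htop
  · have h1 : w ∈ (Submodule.span K {w} : Submodule K (Fin 2 → K)) := Submodule.mem_span_singleton_self w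
    have h2 : Submodule.span K {w} = (⊥ : Submodule K (Fin 2 → K)) :=
      congrArg Subrepresentation.toSubmodule hbot
    rw [h2, Submodule.mem_bot] at h1
    exact hw0 h1
  · have h2 : Submodule.span K {w} = (⊤ : Submodule K (Fin 2 → K)) :=
      congrArg Subrepresentation.toSubmodule htop
    have hdim := congrArg (fun S : Submodule K (Fin 2 → K) => Module.finrank K S) h2
    simp only [finrank_span_singleton hw0, finrank_top, Module.finrank_fin_fun] at hdim
    omega

/-! ### The prime `ker φ` of an irreducible point is off the reducible locus -/

variable {F : Type} [Field F] [NumberField F] {p : ℕ} [Fact p.Prime]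
variable {𝒪 : Type} [CommRing 𝒪] {k : Type} [Field k] [Algebra 𝒪 k] {𝒟 : NearlyOrdinaryDatum F p 𝒪 k}
variable (𝓡 : NearlyOrdinaryDeformationRing.{0} 𝒟)

/-- **`ker φ ∉ reducibleLocus` for an irreducible point.**  Let `φ : R_𝒟 → ℚ̄_p` realise the continuous
IRREDUCIBLE `ρ : Γ_F → GL₂(ℚ̄_p)` up to conjugation.  Then `ρ_𝒟 mod ker φ` is irreducible over
`Frac(R_𝒟/ker φ)`: otherwise, pushing along the embedding `Frac(R_𝒟/ker φ) ↪ ℚ̄_p` extending `φ`,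
`φ ∘ ρ_𝒟 = P⁻¹ ρ P` — hence `ρ` — would be conjugate to an upper-triangular representation.
[cite: SkinnerWiles1999, §4.3] -/
theorem not_mem_reducibleLocus_ker (φ : 𝓡.R →+* PadicAlgCl p) (ρ : FramedGaloisRep F (PadicAlgCl p) 2)
    (hirr : ρ.toGaloisRep.IsIrreducible) (P : GL (Fin 2) (PadicAlgCl p))
    (hreal : ∀ g, Matrix.GeneralLinearGroup.map φ (𝓡.ρ g) = P⁻¹ * ρ g * P) :
    (⟨RingHom.ker φ, RingHom.ker_isPrime φ⟩ : PrimeSpectrum 𝓡.R) ∉ 𝓡.reducibleLocus := by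
  intro hred
  -- notation: `𝔭 = ker φ`, `K = Frac(R/𝔭)`, the embedding `j : K → ℚ̄_p` extending `kerLift φ`
  haveI : (RingHom.ker φ).IsPrime := RingHom.ker_isPrime φ
  set ι : 𝓡.R ⧸ RingHom.ker φ →+* PadicAlgCl p := RingHom.kerLift φ with hι
  have hιinj : Function.Injective ι := RingHom.kerLift_injective φ
  letI : Algebra (𝓡.R ⧸ RingHom.ker φ) (PadicAlgCl p) := ι.toAlgebra
  let j : FractionRing (𝓡.R ⧸ RingHom.ker φ) →ₐ[𝓡.R ⧸ RingHom.ker φ] PadicAlgCl p :=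
    IsFractionRing.liftAlgHom (g := Algebra.ofId (𝓡.R ⧸ RingHom.ker φ) (PadicAlgCl p)) hιinj
  have hj : (j : FractionRing (𝓡.R ⧸ RingHom.ker φ) →+* PadicAlgCl p).comp
      (algebraMap (𝓡.R ⧸ RingHom.ker φ) (FractionRing (𝓡.R ⧸ RingHom.ker φ))) = ι := by
    ext a
    simp [j]
    rfl
  have hφ : ((j : FractionRing (𝓡.R ⧸ RingHom.ker φ) →+* PadicAlgCl p).comp
      (algebraMap (𝓡.R ⧸ RingHom.ker φ) (FractionRing (𝓡.R ⧸ RingHom.ker φ)))).comp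
        (Ideal.Quotient.mk (RingHom.ker φ)) = φ := by
    rw [hj]
    exact RingHom.ext fun r => RingHom.kerLift_mk φ r
  -- push the reducibility over `K` to `ℚ̄_p`
  have hred' : IsReducible ((Matrix.GeneralLinearGroup.map φ).comp 𝓡.ρ) := by
    have h := hred.map (j : FractionRing (𝓡.R ⧸ RingHom.ker φ) →+* PadicAlgCl p)
    rw [NearlyOrdinaryDeformationRing.modPrime, ← MonoidHom.comp_assoc, ← Matrix.GeneralLinearGroup.map_comp,
      ← MonoidHom.comp_assoc, ← Matrix.GeneralLinearGroup.map_comp, hφ] at h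
    exact h
  -- `φ ∘ ρ_𝒟 = P⁻¹ ρ P`, so `ρ` itself is conjugate to an upper-triangular representation
  obtain ⟨Q, hQ⟩ := hred'
  have hρred : IsReducible ρ.toMonoidHom := by
    refine ⟨P * Q, fun g => ?_⟩
    have e : (P * Q)⁻¹ * ρ.toMonoidHom g * (P * Q) = Q⁻¹ * (P⁻¹ * ρ g * P) * Q := by
      change (P * Q)⁻¹ * ρ g * (P * Q) = _
      group
    rw [e, ← hreal g]
    exact hQ g
  exact not_isIrreducible_of_isReducible ρ hρred hirr

omit [Fact p.Prime] in
/-- **Specialisation-closedness: primes below a prime off the reducible locus are off it** (for a datum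
distinguished above `p`, by `reducibleLocus = V({c_γ}) ∪ V({b_γ})`).  With `𝔭 = ker φ` of an
irreducible point: the minimal prime of the component `C_ρ ∋ 𝔭_ρ` — indeed every prime of `C_ρ` below
`𝔭_ρ` — is off the reducible locus. [cite: SkinnerWiles1999, §2.2; §4.3] -/
theorem not_mem_reducibleLocus_of_le
    (hdist : ∃ v : HeightOneSpectrum (𝓞 F), (p : 𝓞 F) ∈ v.asIdeal ∧ 𝒟.IsDistinguishedAt v)
    {C 𝔭 : PrimeSpectrum 𝓡.R} (hC𝔭 : C ≤ 𝔭) (h𝔭 : 𝔭 ∉ 𝓡.reducibleLocus) : C ∉ 𝓡.reducibleLocus := by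
  obtain ⟨v, hv, hd⟩ := hdist
  obtain ⟨D, g₀, h01, h10, hunit⟩ := exists_diagonalFrame 𝓡 hv hd
  rw [reducibleLocus_eq_zeroLocus_union 𝓡 D g₀ h01 h10 hunit] at h𝔭 ⊢
  rintro (hc | hb)
  · apply h𝔭
    refine Or.inl ?_
    rw [PrimeSpectrum.mem_zeroLocus] at hc ⊢
    exact hc.trans ((PrimeSpectrum.asIdeal_le_asIdeal C 𝔭).mpr hC𝔭)
  · apply h𝔭
    refine Or.inr ?_
    rw [PrimeSpectrum.mem_zeroLocus] at hb ⊢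
    exact hb.trans ((PrimeSpectrum.asIdeal_le_asIdeal C 𝔭).mpr hC𝔭)

/-- **The component of an irreducible point is off the reducible locus**: combining the two, for
`φ : R_𝒟 → ℚ̄_p` realising an irreducible `ρ` and any prime `C ⊆ ker φ` (e.g. the minimal prime of
`C_ρ`), `C ∉ reducibleLocus 𝓡`. [cite: SkinnerWiles1999, §4.3] -/
theorem not_mem_reducibleLocus_of_le_ker
    (hdist : ∃ v : HeightOneSpectrum (𝓞 F), (p : 𝓞 F) ∈ v.asIdeal ∧ 𝒟.IsDistinguishedAt v)
    (φ : 𝓡.R →+* PadicAlgCl p) (ρ : FramedGaloisRep F (PadicAlgCl p) 2)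
    (hirr : ρ.toGaloisRep.IsIrreducible) (P : GL (Fin 2) (PadicAlgCl p))
    (hreal : ∀ g, Matrix.GeneralLinearGroup.map φ (𝓡.ρ g) = P⁻¹ * ρ g * P)
    {C : PrimeSpectrum 𝓡.R} (hC : C.asIdeal ≤ RingHom.ker φ) : C ∉ 𝓡.reducibleLocus :=
  not_mem_reducibleLocus_of_le 𝓡 hdist
    ((PrimeSpectrum.asIdeal_le_asIdeal C ⟨RingHom.ker φ, RingHom.ker_isPrime φ⟩).mp hC)
    (not_mem_reducibleLocus_ker 𝓡 φ ρ hirr P hreal)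

end

end Summit.Langlands.Langlands.Theorems
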